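import Mathlib
import HarnessLib
import Literature.MathematicalPhysics.QuantumLattice.HubbardUVSymbolCTMixedDifferences
import Summits.HubbardSuperconductivity.HubbardSuperconductivity.Theorems.KLProgrammeKLRegimeEngineScaleZeroDecay

/-!
# Route `KLProgramme`, crux K3 child ENGINE (`KLRegimeEngineV14`, stmt-HubbardSuperconductivity-19918), stub `stub_engine_scale0`, conjunct (E4)₀:
# the `ℓ²` norms of the MIXED differences of the scale-`0` covariance symbol of an admissible frame, uniform in `M`, `β`, `L`

Cell gate-hubbard-kl, seat hubbard-kl-k3c4-p2 (SPEC P2 of the (E4)₀ owner k3c2-p1: the time-moment `A_T` of the weighted decay constant of the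
scale-`0` covariance on the `2(2M)` grid).  The FIRST MOMENTS of the scale-`0` covariance `Sᵀ C^K_{>e₀} S` with the product weight
`(1 + c₀|x₀|²)(1 + c₁|x₁|²)(1 + c₂|x₂|²)` are priced (`TorusFourierWeightedL1Mixed.sum_sum_mixedWeight_mul_norm_sq_le`) by the `ℓ²` norms
`Σ_{q₀,q⃗} ‖Δ_u^a(Δ_{e_l}^bΔ_{e_{l'}}^c G)(q₀)(q⃗)‖²` of the mixed differences of the padded symbol `G = gridSymbol L M N β (uvSymbolCT L M β μ K klE0) σ`.
The Literature side (`HubbardUVSymbolCTMixedDifferences.sum_norm_sq_mixedDiff_uvSymbolCT_le`) bounds them for every time order `a` with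
`a + 1 ≤ M` and `b, c ≤ 1`, under `UVSurfaceBound μ K D` (the frame band along any two lattice directions has `∂_s, ∂_t, ∂_s∂_t` bounded by
`D`).  Here (§1) that hypothesis is discharged from `FrameOK` — `GeomConstants (frameLevel μ K) 7 …`: every derivative of order `≤ 2` of
`e_K` on `Momentum` has norm `≤ 7`, and the two lattice directions are unit vectors — with `D = 7`, and (§2) the bound is restated at
`Λ = klE0` on any `N`-point time grid with `2M ≤ N` (the engine's `N = 2(2M)`) under the stub's `klBetaMin ≤ β`.  The constants `uvSurfaceConst klE0 7 a m` are by-name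
absolute constants (choices of existentials depending on `klE0, a, m` only; (R7)-legal).

* **`uvSurfaceBound_of_frameOK`** — `FrameOK ⟹ UVSurfaceBound μ K 7`;
* **`sum_norm_sq_mixedDiff_scaleZero_of_frameOK`** — the `ℓ²` bound of the mixed differences at `Λ = klE0`, every `a + 1 ≤ M`, `b, c ≤ 1`.
-/

noncomputable section

namespace Summit.HubbardSuperconductivity.HubbardSuperconductivity.Theorems.ScaleZeroDecay

set_option linter.dupNamespace false -- summit = problem name (single-conjunct summit), D-0017

open Real Finset Literature.MathematicalPhysics.QuantumLattice Literature.Probability.LatticeModels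
open Literature.MathematicalPhysics.QuantumLattice.FermiRG
open Summit.HubbardSuperconductivity.HubbardSuperconductivity.Theorems.KLRegimeSplit
open Summit.HubbardSuperconductivity.HubbardSuperconductivity.Theorems.DispersionFlow
open Summit.HubbardSuperconductivity.HubbardSuperconductivity.Theorems.EngineV8

/-! ## §1 Admissible frames have bounded band geometry along pairs of lattice directions: `FrameOK ⟹ UVSurfaceBound μ K 7` -/

/-- The surface of the band through `p` along `e_l, e_{l'}` is the restriction of `frameLevel` to the affine plane
`(s,t) ↦ toLp p + s·e_l + t·e_{l'}` of `Momentum`. -/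
theorem ctSurface_eq_frameLevel (μ : ℝ) (K : TrigPolyC4v) (p : Fin 2 → ℝ) (l l' : Fin 2) (s t : ℝ) :
    ctSurface μ K p l l' s t =
      frameLevel μ K (WithLp.toLp 2 p + s • EuclideanSpace.single l (1 : ℝ) + t • EuclideanSpace.single l' (1 : ℝ)) := by
  rw [ctSurface, ← frameLevel_toLp_eq_ctBandFn]
  rfl

/-- **`FrameOK ⟹ UVSurfaceBound μ K 7`**: along every pair of lattice directions the band `(s,t) ↦ e_K(p + s e_l + t e_{l'})` of an admissible
frame has `|∂_s|, |∂_t|, |∂_t∂_s| ≤ 7` (`GeomConstants`: `‖D e_K‖, ‖D² e_K‖ ≤ 7` everywhere; the directions have unit norm). -/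
theorem uvSurfaceBound_of_frameOK {R : RenConsts} {U : ℝ} {N : ℕ} {μ : ℝ} {K : TrigPolyC4v} (hK : FrameOK R U N μ K) :
    UVSurfaceBound μ K 7 := by
  intro p l l'
  set f : EuclideanSpace ℝ (Fin 2) → ℝ := frameLevel μ K with hf
  set v : EuclideanSpace ℝ (Fin 2) := EuclideanSpace.single l (1 : ℝ) with hv
  set w : EuclideanSpace ℝ (Fin 2) := EuclideanSpace.single l' (1 : ℝ) with hw
  set P : EuclideanSpace ℝ (Fin 2) := WithLp.toLp 2 p with hP
  have hC : ContDiff ℝ 2 f := contDiff_frameLevel μ K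
  have hG : GeomConstants f 7 (3 / 80) (1 / 2) (3 / 200) := hK.1
  have hvn : ‖v‖ = 1 := by simp [hv]
  have hwn : ‖w‖ = 1 := by simp [hw]
  -- first and second derivative as functions on `Momentum`
  have hdf : Differentiable ℝ f := hC.differentiable (by norm_num)
  set g : EuclideanSpace ℝ (Fin 2) → ℝ := fun x => fderiv ℝ f x v with hg
  have hC1 : ContDiff ℝ 1 (fderiv ℝ f) := hC.fderiv_right (m := 1) (by norm_num)
  have hgC : ContDiff ℝ 1 g := hC1.clm_apply contDiff_const
  have hdg : Differentiable ℝ g := hgC.differentiable (by norm_num)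
  have hfg : ∀ x, fderiv ℝ g x w = iteratedFDeriv ℝ 2 f x ![w, v] := by
    intro x
    rw [iteratedFDeriv_two_apply, hg, fderiv_clm_apply (hC1.differentiable (by norm_num) x) (differentiableAt_const v),
      fderiv_fun_const]
    simp
  -- the surface is `f` along the affine plane
  have hsurf : ∀ s t, ctSurface μ K p l l' s t = f (P + s • v + t • w) := fun s t => ctSurface_eq_frameLevel μ K p l l' s t
  -- the paths
  have hps : ∀ s t : ℝ, HasDerivAt (fun s' : ℝ => P + s' • v + t • w) v s := by
    intro s t
    have h1 := (((hasDerivAt_id s).smul_const v).const_add P).add_const (t • w)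
    simpa using h1
  have hpt : ∀ s t : ℝ, HasDerivAt (fun t' : ℝ => P + s • v + t' • w) w t := by
    intro s t
    have h1 := ((hasDerivAt_id t).smul_const w).const_add (P + s • v)
    simpa using h1
  refine ⟨fun s t => fderiv ℝ f (P + s • v + t • w) v, fun s t => fderiv ℝ f (P + s • v + t • w) w,
    fun s t => fderiv ℝ g (P + s • v + t • w) w, fun s t => ?_, fun s t => ?_, fun s t => ?_, fun s t => ⟨?_, ?_, ?_⟩⟩
  · have h := HasFDerivAt.comp_hasDerivAt (f := fun s' : ℝ => P + s' • v + t • w) (x := s)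
      (hdf (P + s • v + t • w)).hasFDerivAt (hps s t)
    have hfun : (fun s' => ctSurface μ K p l l' s' t) = f ∘ fun s' : ℝ => P + s' • v + t • w := by
      funext s'; exact hsurf s' t
    rw [hfun]; exact h
  · have h := HasFDerivAt.comp_hasDerivAt (f := fun t' : ℝ => P + s • v + t' • w) (x := t)
      (hdf (P + s • v + t • w)).hasFDerivAt (hpt s t)
    have hfun : (fun t' => ctSurface μ K p l l' s t') = f ∘ fun t' : ℝ => P + s • v + t' • w := by
      funext t'; exact hsurf s t'
    rw [hfun]; exact h
  · have h := HasFDerivAt.comp_hasDerivAt (f := fun t' : ℝ => P + s • v + t' • w) (x := t)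
      (hdg (P + s • v + t • w)).hasFDerivAt (hpt s t)
    exact h
  · -- `|Df(x)·v| ≤ ‖Df(x)‖ ≤ 7`
    show |fderiv ℝ f (P + s • v + t • w) v| ≤ 7
    set x := P + s • v + t • w
    have h1 : fderiv ℝ f x v = iteratedFDeriv ℝ 1 f x (fun _ => v) := by rw [iteratedFDeriv_one_apply]
    rw [h1, ← Real.norm_eq_abs]
    refine (ContinuousMultilinearMap.le_opNorm _ _).trans ?_
    rw [Fin.prod_univ_one, hvn, mul_one]
    exact hG.norm_iteratedFDeriv_le x 1 (by norm_num)
  · show |fderiv ℝ f (P + s • v + t • w) w| ≤ 7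
    set x := P + s • v + t • w
    have h1 : fderiv ℝ f x w = iteratedFDeriv ℝ 1 f x (fun _ => w) := by rw [iteratedFDeriv_one_apply]
    rw [h1, ← Real.norm_eq_abs]
    refine (ContinuousMultilinearMap.le_opNorm _ _).trans ?_
    rw [Fin.prod_univ_one, hwn, mul_one]
    exact hG.norm_iteratedFDeriv_le x 1 (by norm_num)
  · -- `|D²f(x)[w,v]| ≤ ‖D²f(x)‖ ≤ 7`
    show |fderiv ℝ g (P + s • v + t • w) w| ≤ 7
    set x := P + s • v + t • w
    rw [hfg x, ← Real.norm_eq_abs]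
    refine (ContinuousMultilinearMap.le_opNorm _ _).trans ?_
    rw [Fin.prod_univ_two]
    simp only [Matrix.cons_val_zero, Matrix.cons_val_one]
    rw [hvn, hwn, mul_one, mul_one]
    exact hG.norm_iteratedFDeriv_le x 2 le_rfl

/-! ## §2 The mixed-difference `ℓ²` bounds of the scale-`0` covariance symbol on the engine's grid `N = 2(2M)` at `Λ = klE0` -/

section Grid

variable {R : RenConsts} {U : ℝ} {Nsc : ℕ} {μ : ℝ} {K : TrigPolyC4v} {β : ℝ} {L M N : ℕ} [NeZero L] [NeZero N]

/-- **The `ℓ²` norm of the mixed differences `Δ_u^a Δ_{e_l}^b Δ_{e_{l'}}^c` of the scale-`0` covariance symbol of an admissible frame** on an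
`N`-point time grid with `2M ≤ N` (the engine's is `N = 2(2M)`) at `Λ = klE0` (`D = 7` from `FrameOK`; every time order `a` with `a + 1 ≤ M`,
space orders `b, c ≤ 1`, `l = l'` allowed; `n = a + min(b+c,1) + 1`): interior Matsubara sum plus `≤ 2a` edge rows — the right-hand side
of `TorusFourierWeightedL1Mixed.sum_sum_mixedWeight_mul_norm_sq_le` for the time moment `A_T` of (E4)₀. -/
theorem sum_norm_sq_mixedDiff_scaleZero_of_frameOK (hK : FrameOK R U Nsc μ K) (hβ : klBetaMin ≤ β) {a : ℕ} (haM : a + 1 ≤ M)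
    (hMN : 2 * M ≤ N) (σ : Fin 2) (l l' : Fin 2) {b c : ℕ} (hb : b ≤ 1) (hc : c ≤ 1) :
    ∑ q₀ : TorusSite 1 N, ∑ qv : TorusSite 2 L,
        ‖(fwdDiff (fun _ : Fin 1 => (1 : ZMod N)))^[a]
          (fun q => ((fwdDiff (Pi.single l (1 : ZMod L) : TorusSite 2 L))^[b]
            ((fwdDiff (Pi.single l' (1 : ZMod L) : TorusSite 2 L))^[c]
              (gridSymbol L M N β (uvSymbolCT L M β μ K klE0) σ q))) qv) q₀‖ ^ 2 ≤
      (L : ℝ) ^ 2 * ((1 / (β * (L : ℝ) ^ 2) * ((2 * Real.pi / β) ^ a * (2 * Real.pi / L) ^ (b + c) *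
          uvSurfaceConst klE0 7 a (b + c))) ^ 2 *
        (4 ^ (a + min (b + c) 1 + 1) * ((2 / klE0) ^ (2 * (a + min (b + c) 1 + 1) - 2) * (2 * β / klE0)) +
          4 * a * (2 / klE0) ^ (2 * (a + min (b + c) 1 + 1)))) +
      2 * a * ((L : ℝ) ^ 2 * (2 ^ a * (1 / (β * (L : ℝ) ^ 2) * ((2 * Real.pi / L) ^ (b + c) *
          (uvSurfaceConst klE0 7 0 (b + c) / max (Real.pi * (2 * M - 2 * a + 1) / β) (klE0 / 2) ^ (min (b + c) 1 + 1))))) ^ 2) := by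
  exact sum_norm_sq_mixedDiff_uvSymbolCT_le (beta_pos_of_klBetaMin_le hβ) (by norm_num [klE0]) (by norm_num)
    (uvSurfaceBound_of_frameOK hK) haM hMN σ l l' hb hc

end Grid

end Summit.HubbardSuperconductivity.HubbardSuperconductivity.Theorems.ScaleZeroDecay

end
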